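import Mathlib.Data.Real.Basic
import Mathlib.Tactic.Linarith
import Mathlib.Tactic.Positivity
import Mathlib.Tactic.Ring
import Summits.CriticalPhenomena.PercolationContinuityZ3.Theorems.PercNearOneGluingNoHeavyLowerTailAPLConjF
import Summits.CriticalPhenomena.PercolationContinuityZ3.Theorems.PercNearOneGluingNoHeavyLowerTailAPLConjFUnionPP
import Summits.CriticalPhenomena.PercolationContinuityZ3.Theorems.PercNearOneGluingNoHeavyLowerTailAPLConjFUnionDenseCells
import Summits.CriticalPhenomena.PercolationContinuityZ3.Theorems.PercNearOneGluingNoHeavyLowerTailAPLConjFUnionCCCells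
import HarnessLib

/-!
# `NoHeavyLowerTail` (stmt-CriticalPhenomena-4575) — CONJECTURE F under apex piece-union: LEMMA U″ assembled for every pair that is not doubly b-leaning

Support file (prover prim-ineq-gen-8 gen 35; `--supports stmt-CriticalPhenomena-4575`; memos
run/shared/lean/prim/prim-ineq-gen-8/FINDING-gen34-CONJF.md §0(4) and FINDING-gen35-CONJF-UNION.md §7).
Pure real algebra: no definitions, no named facts, no sorries.

LEMMA U″ (memo gen 34): if two nonnegative cell vectors `u = (u0,uab,uac,ubc,u3)`, `v` (instances `(a; b, c)` of two pieces meeting only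
in `{a,b,c}`) both satisfy `F_b`, `F_c` (prim-cert-1's CONJECTURE F), the Gladkov–Zimin inequality (5.1) at the apex, Harris
`e·S ≤ T·D` and APL-G `(T·D − e·S)² ≤ uab·uac·S²`, then their apex piece-union `w` satisfies `F_b` and `F_c`.  This file assembles the
leaf theorems of gens 34–35 into that statement for every leaning configuration except "both pieces b-leaning, target `F_c`" (equivalently
"both c-leaning, target `F_b`"), which is certified only by an exact rational certificate outside Lean (memo gen 35 §4):
* `conjF_c_union_mixed_all` / `conjF_b_union_mixed_all` — `u` b-leaning (`uac ≤ uab`), `v` c-leaning (`vab ≤ vac`): BOTH `F_c(w)` and `F_b(w)`;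
  case split light (`conjF_c_union_of_light`, gen 34) / `vbc ≥ e_v` (`conjF_c_union_mixed_pp`) / `vbc ≤ e_v` (`conjF_c_union_mixed_dense`);
* `conjF_c_union_cc_all` — both c-leaning: `F_c(w)`;  `conjF_b_union_bb_all` — both b-leaning: `F_b(w)` (light / `conjF_c_union_cc`).
The u ↔ v swap uses the symmetry of the union cells (`ring`). [folklore algebra]
-/

namespace Summit.CriticalPhenomena.PercolationContinuityZ3.Theorems

namespace APL

/-- The `F_c`-slack of the apex piece-union is symmetric under swapping the two pieces. [folklore] -/
theorem conjF_c_union_swap (u0 uab uac ubc u3 v0 vab vac vbc v3 : ℝ) :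
    3*((u0*vab+uab*v0+uab*vab)+(u0*vac+uac*v0+uac*vac))*(u0*v0+(u0*vab+uab*v0+uab*vab)+(u0*vac+uac*v0+uac*vac)+(u0*vbc+ubc*v0+ubc*vbc)+(u3*(v0+vab+vac+vbc+v3)+(u0+uab+uac+ubc+u3)*v3-u3*v3+uab*(vac+vbc)+uac*(vab+vbc)+ubc*(vab+vac))) - (u0*v0+(u0*vab+uab*v0+uab*vab)+(u0*vac+uac*v0+uac*vac))*(3*(u0*vab+uab*v0+uab*vab)+(u0*vac+uac*v0+uac*vac)+2*(u3*(v0+vab+vac+vbc+v3)+(u0+uab+uac+ubc+u3)*v3-u3*v3+uab*(vac+vbc)+uac*(vab+vbc)+ubc*(vab+vac)))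
    = 3*((v0*uab+vab*u0+vab*uab)+(v0*uac+vac*u0+vac*uac))*(v0*u0+(v0*uab+vab*u0+vab*uab)+(v0*uac+vac*u0+vac*uac)+(v0*ubc+vbc*u0+vbc*ubc)+(v3*(u0+uab+uac+ubc+u3)+(v0+vab+vac+vbc+v3)*u3-v3*u3+vab*(uac+ubc)+vac*(uab+ubc)+vbc*(uab+uac))) - (v0*u0+(v0*uab+vab*u0+vab*uab)+(v0*uac+vac*u0+vac*uac))*(3*(v0*uab+vab*u0+vab*uab)+(v0*uac+vac*u0+vac*uac)+2*(v3*(u0+uab+uac+ubc+u3)+(v0+vab+vac+vbc+v3)*u3-v3*u3+vab*(uac+ubc)+vac*(uab+ubc)+vbc*(uab+uac))) := by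
  ring

set_option maxHeartbeats 800000 in
/-- **LEMMA U″, mixed-leaning pair, target `F_c`.**  `u, v ≥ 0`; `u` b-leaning (`uac ≤ uab`), `v` c-leaning (`vab ≤ vac`); both
satisfy `F_b`, `F_c`, GZ (5.1), Harris and APL-G.  Then `F_c(u ∪ v) ≥ 0`. [folklore] -/
theorem conjF_c_union_mixed_all (u0 uab uac ubc u3 v0 vab vac vbc v3 : ℝ)
    (hu0 : 0 ≤ u0) (huab : 0 ≤ uab) (huac : 0 ≤ uac) (hubc : 0 ≤ ubc) (hu3 : 0 ≤ u3)
    (hv0 : 0 ≤ v0) (hvab : 0 ≤ vab) (hvac : 0 ≤ vac) (hvbc : 0 ≤ vbc) (hv3 : 0 ≤ v3)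
    (hub : uac ≤ uab) (hvc : vab ≤ vac)
    (hFBu : 0 ≤ 3*(uab+uac)*(u0+uab+uac+ubc+u3) - (u0+uab+uac)*(uab+3*uac+2*u3))
    (hFCu : 0 ≤ 3*(uab+uac)*(u0+uab+uac+ubc+u3) - (u0+uab+uac)*(3*uab+uac+2*u3))
    (hGZu : 0 ≤ (uab+uac+ubc)*(u0+uab+uac+ubc+u3) - uab^2 - uac^2 - (u0+ubc)*(uab+uac+u3))
    (hHu : (uab+uac)*(u0+uab+uac+ubc+u3) ≤ (uab+uac+u3)*(u0+uab+uac))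
    (hGu : ((uab+uac+u3)*(u0+uab+uac) - (uab+uac)*(u0+uab+uac+ubc+u3))^2 ≤ uab*uac*(u0+uab+uac+ubc+u3)^2)
    (hFBv : 0 ≤ 3*(vab+vac)*(v0+vab+vac+vbc+v3) - (v0+vab+vac)*(vab+3*vac+2*v3))
    (hFCv : 0 ≤ 3*(vab+vac)*(v0+vab+vac+vbc+v3) - (v0+vab+vac)*(3*vab+vac+2*v3))
    (hGZv : 0 ≤ (vab+vac+vbc)*(v0+vab+vac+vbc+v3) - vab^2 - vac^2 - (v0+vbc)*(vab+vac+v3))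
    (hHv : (vab+vac)*(v0+vab+vac+vbc+v3) ≤ (vab+vac+v3)*(v0+vab+vac))
    (hGv : ((vab+vac+v3)*(v0+vab+vac) - (vab+vac)*(v0+vab+vac+vbc+v3))^2 ≤ vab*vac*(v0+vab+vac+vbc+v3)^2) :
    0 ≤ 3*((u0*vab+uab*v0+uab*vab)+(u0*vac+uac*v0+uac*vac))*(u0*v0+(u0*vab+uab*v0+uab*vab)+(u0*vac+uac*v0+uac*vac)+(u0*vbc+ubc*v0+ubc*vbc)+(u3*(v0+vab+vac+vbc+v3)+(u0+uab+uac+ubc+u3)*v3-u3*v3+uab*(vac+vbc)+uac*(vab+vbc)+ubc*(vab+vac))) - (u0*v0+(u0*vab+uab*v0+uab*vab)+(u0*vac+uac*v0+uac*vac))*(3*(u0*vab+uab*v0+uab*vab)+(u0*vac+uac*v0+uac*vac)+2*(u3*(v0+vab+vac+vbc+v3)+(u0+uab+uac+ubc+u3)*v3-u3*v3+uab*(vac+vbc)+uac*(vab+vbc)+ubc*(vab+vac))) := by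
  rcases le_or_gt (2*u0) (uab+uac) with hlu | hlu
  · exact conjF_c_union_of_light u0 uab uac ubc u3 v0 vab vac vbc v3 hu0 huab huac hubc hu3 hFBu hFCu hGZu (by linarith)
      hv0 hvab hvac hvbc hv3
  rcases le_or_gt (2*v0) (vab+vac) with hlv | hlv
  · rw [conjF_c_union_swap]
    exact conjF_c_union_of_light v0 vab vac vbc v3 u0 uab uac ubc u3 hv0 hvab hvac hvbc hv3 hFBv hFCv hGZv (by linarith)
      hu0 huab huac hubc hu3
  rcases le_or_gt (vab+vac) vbc with hd | hd
  · exact conjF_c_union_mixed_pp u0 uab uac ubc u3 v0 vab vac vbc v3 hu0 huab huac hubc hu3 hv0 hvab hvac hvbc hv3 hub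
      (le_of_lt hlu) hHu hGu hFCu hvc (le_of_lt hlv) hd hHv hGv
  · exact conjF_c_union_mixed_dense u0 uab uac ubc u3 v0 vab vac vbc v3 hu0 huab huac hubc hu3 hv0 hvab hvac hvbc hv3 hub
      (le_of_lt hlu) hFCu hvc (le_of_lt hlv) hHv hGv hGZv (le_of_lt hd)

set_option maxHeartbeats 800000 in
/-- **LEMMA U″, mixed-leaning pair, target `F_b`** (same hypotheses as `conjF_c_union_mixed_all`): `F_b(u ∪ v) ≥ 0`.
Proof: `F_b` of `u ∪ v` is `F_c` of the `b ↔ c`-mirrored, swapped pair `(v̄, ū)`, again a (b-leaning, c-leaning) pair. [folklore] -/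
theorem conjF_b_union_mixed_all (u0 uab uac ubc u3 v0 vab vac vbc v3 : ℝ)
    (hu0 : 0 ≤ u0) (huab : 0 ≤ uab) (huac : 0 ≤ uac) (hubc : 0 ≤ ubc) (hu3 : 0 ≤ u3)
    (hv0 : 0 ≤ v0) (hvab : 0 ≤ vab) (hvac : 0 ≤ vac) (hvbc : 0 ≤ vbc) (hv3 : 0 ≤ v3)
    (hub : uac ≤ uab) (hvc : vab ≤ vac)
    (hFBu : 0 ≤ 3*(uab+uac)*(u0+uab+uac+ubc+u3) - (u0+uab+uac)*(uab+3*uac+2*u3))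
    (hFCu : 0 ≤ 3*(uab+uac)*(u0+uab+uac+ubc+u3) - (u0+uab+uac)*(3*uab+uac+2*u3))
    (hGZu : 0 ≤ (uab+uac+ubc)*(u0+uab+uac+ubc+u3) - uab^2 - uac^2 - (u0+ubc)*(uab+uac+u3))
    (hHu : (uab+uac)*(u0+uab+uac+ubc+u3) ≤ (uab+uac+u3)*(u0+uab+uac))
    (hGu : ((uab+uac+u3)*(u0+uab+uac) - (uab+uac)*(u0+uab+uac+ubc+u3))^2 ≤ uab*uac*(u0+uab+uac+ubc+u3)^2)
    (hFBv : 0 ≤ 3*(vab+vac)*(v0+vab+vac+vbc+v3) - (v0+vab+vac)*(vab+3*vac+2*v3))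
    (hFCv : 0 ≤ 3*(vab+vac)*(v0+vab+vac+vbc+v3) - (v0+vab+vac)*(3*vab+vac+2*v3))
    (hGZv : 0 ≤ (vab+vac+vbc)*(v0+vab+vac+vbc+v3) - vab^2 - vac^2 - (v0+vbc)*(vab+vac+v3))
    (hHv : (vab+vac)*(v0+vab+vac+vbc+v3) ≤ (vab+vac+v3)*(v0+vab+vac))
    (hGv : ((vab+vac+v3)*(v0+vab+vac) - (vab+vac)*(v0+vab+vac+vbc+v3))^2 ≤ vab*vac*(v0+vab+vac+vbc+v3)^2) :
    0 ≤ 3*((u0*vab+uab*v0+uab*vab)+(u0*vac+uac*v0+uac*vac))*(u0*v0+(u0*vab+uab*v0+uab*vab)+(u0*vac+uac*v0+uac*vac)+(u0*vbc+ubc*v0+ubc*vbc)+(u3*(v0+vab+vac+vbc+v3)+(u0+uab+uac+ubc+u3)*v3-u3*v3+uab*(vac+vbc)+uac*(vab+vbc)+ubc*(vab+vac))) - (u0*v0+(u0*vab+uab*v0+uab*vab)+(u0*vac+uac*v0+uac*vac))*((u0*vab+uab*v0+uab*vab)+3*(u0*vac+uac*v0+uac*vac)+2*(u3*(v0+vab+vac+vbc+v3)+(u0+uab+uac+ubc+u3)*v3-u3*v3+uab*(vac+vbc)+uac*(vab+vbc)+ubc*(vab+vac)))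 := by
  -- apply the F_c theorem to (v̄, ū): v̄ = (v0, vac, vab, vbc, v3) is b-leaning, ū = (u0, uac, uab, ubc, u3) is c-leaning
  have h := conjF_c_union_mixed_all v0 vac vab vbc v3 u0 uac uab ubc u3 hv0 hvac hvab hvbc hv3 hu0 huac huab hubc hu3 hvc hub
    (by have e : 3*(vac+vab)*(v0+vac+vab+vbc+v3) - (v0+vac+vab)*(vac+3*vab+2*v3)
          = 3*(vab+vac)*(v0+vab+vac+vbc+v3) - (v0+vab+vac)*(3*vab+vac+2*v3) := by ring
        rw [e]; exact hFCv)
    (by have e : 3*(vac+vab)*(v0+vac+vab+vbc+v3) - (v0+vac+vab)*(3*vac+vab+2*v3)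
          = 3*(vab+vac)*(v0+vab+vac+vbc+v3) - (v0+vab+vac)*(vab+3*vac+2*v3) := by ring
        rw [e]; exact hFBv)
    (by have e : (vac+vab+vbc)*(v0+vac+vab+vbc+v3) - vac^2 - vab^2 - (v0+vbc)*(vac+vab+v3)
          = (vab+vac+vbc)*(v0+vab+vac+vbc+v3) - vab^2 - vac^2 - (v0+vbc)*(vab+vac+v3) := by ring
        rw [e]; exact hGZv)
    (by have e1 : (vac+vab)*(v0+vac+vab+vbc+v3) = (vab+vac)*(v0+vab+vac+vbc+v3) := by ring
        have e2 : (vac+vab+v3)*(v0+vac+vab) = (vab+vac+v3)*(v0+vab+vac) := by ring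
        rw [e1, e2]; exact hHv)
    (by have e1 : ((vac+vab+v3)*(v0+vac+vab) - (vac+vab)*(v0+vac+vab+vbc+v3))^2
          = ((vab+vac+v3)*(v0+vab+vac) - (vab+vac)*(v0+vab+vac+vbc+v3))^2 := by ring
        have e2 : vac*vab*(v0+vac+vab+vbc+v3)^2 = vab*vac*(v0+vab+vac+vbc+v3)^2 := by ring
        rw [e1, e2]; exact hGv)
    (by have e : 3*(uac+uab)*(u0+uac+uab+ubc+u3) - (u0+uac+uab)*(uac+3*uab+2*u3)
          = 3*(uab+uac)*(u0+uab+uac+ubc+u3) - (u0+uab+uac)*(3*uab+uac+2*u3) := by ring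
        rw [e]; exact hFCu)
    (by have e : 3*(uac+uab)*(u0+uac+uab+ubc+u3) - (u0+uac+uab)*(3*uac+uab+2*u3)
          = 3*(uab+uac)*(u0+uab+uac+ubc+u3) - (u0+uab+uac)*(uab+3*uac+2*u3) := by ring
        rw [e]; exact hFBu)
    (by have e : (uac+uab+ubc)*(u0+uac+uab+ubc+u3) - uac^2 - uab^2 - (u0+ubc)*(uac+uab+u3)
          = (uab+uac+ubc)*(u0+uab+uac+ubc+u3) - uab^2 - uac^2 - (u0+ubc)*(uab+uac+u3) := by ring
        rw [e]; exact hGZu)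
    (by have e1 : (uac+uab)*(u0+uac+uab+ubc+u3) = (uab+uac)*(u0+uab+uac+ubc+u3) := by ring
        have e2 : (uac+uab+u3)*(u0+uac+uab) = (uab+uac+u3)*(u0+uab+uac) := by ring
        rw [e1, e2]; exact hHu)
    (by have e1 : ((uac+uab+u3)*(u0+uac+uab) - (uac+uab)*(u0+uac+uab+ubc+u3))^2
          = ((uab+uac+u3)*(u0+uab+uac) - (uab+uac)*(u0+uab+uac+ubc+u3))^2 := by ring
        have e2 : uac*uab*(u0+uac+uab+ubc+u3)^2 = uab*uac*(u0+uab+uac+ubc+u3)^2 := by ring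
        rw [e1, e2]; exact hGu)
  have e : 3*((u0*vab+uab*v0+uab*vab)+(u0*vac+uac*v0+uac*vac))*(u0*v0+(u0*vab+uab*v0+uab*vab)+(u0*vac+uac*v0+uac*vac)+(u0*vbc+ubc*v0+ubc*vbc)+(u3*(v0+vab+vac+vbc+v3)+(u0+uab+uac+ubc+u3)*v3-u3*v3+uab*(vac+vbc)+uac*(vab+vbc)+ubc*(vab+vac))) - (u0*v0+(u0*vab+uab*v0+uab*vab)+(u0*vac+uac*v0+uac*vac))*((u0*vab+uab*v0+uab*vab)+3*(u0*vac+uac*v0+uac*vac)+2*(u3*(v0+vab+vac+vbc+v3)+(u0+uab+uac+ubc+u3)*v3-u3*v3+uab*(vac+vbc)+uac*(vab+vbc)+ubc*(vab+vac)))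
      = 3*((v0*uac+vac*u0+vac*uac)+(v0*uab+vab*u0+vab*uab))*(v0*u0+(v0*uac+vac*u0+vac*uac)+(v0*uab+vab*u0+vab*uab)+(v0*ubc+vbc*u0+vbc*ubc)+(v3*(u0+uac+uab+ubc+u3)+(v0+vac+vab+vbc+v3)*u3-v3*u3+vac*(uab+ubc)+vab*(uac+ubc)+vbc*(uac+uab))) - (v0*u0+(v0*uac+vac*u0+vac*uac)+(v0*uab+vab*u0+vab*uab))*(3*(v0*uac+vac*u0+vac*uac)+(v0*uab+vab*u0+vab*uab)+2*(v3*(u0+uac+uab+ubc+u3)+(v0+vac+vab+vbc+v3)*u3-v3*u3+vac*(uab+ubc)+vab*(uac+ubc)+vbc*(uac+uab))) := by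
    ring
  rw [e]; exact h

set_option maxHeartbeats 800000 in
/-- **LEMMA U″, two c-leaning pieces, target `F_c`.**  `u, v ≥ 0`, `uab ≤ uac`, `vab ≤ vac`, both satisfy `F_b`, `F_c` and GZ (5.1)
(GZ only enters in the light case).  Then `F_c(u ∪ v) ≥ 0`. [folklore] -/
theorem conjF_c_union_cc_all (u0 uab uac ubc u3 v0 vab vac vbc v3 : ℝ)
    (hu0 : 0 ≤ u0) (huab : 0 ≤ uab) (huac : 0 ≤ uac) (hubc : 0 ≤ ubc) (hu3 : 0 ≤ u3)
    (hv0 : 0 ≤ v0) (hvab : 0 ≤ vab) (hvac : 0 ≤ vac) (hvbc : 0 ≤ vbc) (hv3 : 0 ≤ v3)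
    (huc : uab ≤ uac) (hvc : vab ≤ vac)
    (hFBu : 0 ≤ 3*(uab+uac)*(u0+uab+uac+ubc+u3) - (u0+uab+uac)*(uab+3*uac+2*u3))
    (hFCu : 0 ≤ 3*(uab+uac)*(u0+uab+uac+ubc+u3) - (u0+uab+uac)*(3*uab+uac+2*u3))
    (hGZu : 0 ≤ (uab+uac+ubc)*(u0+uab+uac+ubc+u3) - uab^2 - uac^2 - (u0+ubc)*(uab+uac+u3))
    (hFBv : 0 ≤ 3*(vab+vac)*(v0+vab+vac+vbc+v3) - (v0+vab+vac)*(vab+3*vac+2*v3))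
    (hFCv : 0 ≤ 3*(vab+vac)*(v0+vab+vac+vbc+v3) - (v0+vab+vac)*(3*vab+vac+2*v3))
    (hGZv : 0 ≤ (vab+vac+vbc)*(v0+vab+vac+vbc+v3) - vab^2 - vac^2 - (v0+vbc)*(vab+vac+v3)) :
    0 ≤ 3*((u0*vab+uab*v0+uab*vab)+(u0*vac+uac*v0+uac*vac))*(u0*v0+(u0*vab+uab*v0+uab*vab)+(u0*vac+uac*v0+uac*vac)+(u0*vbc+ubc*v0+ubc*vbc)+(u3*(v0+vab+vac+vbc+v3)+(u0+uab+uac+ubc+u3)*v3-u3*v3+uab*(vac+vbc)+uac*(vab+vbc)+ubc*(vab+vac))) - (u0*v0+(u0*vab+uab*v0+uab*vab)+(u0*vac+uac*v0+uac*vac))*(3*(u0*vab+uab*v0+uab*vab)+(u0*vac+uac*v0+uac*vac)+2*(u3*(v0+vab+vac+vbc+v3)+(u0+uab+uac+ubc+u3)*v3-u3*v3+uab*(vac+vbc)+uac*(vab+vbc)+ubc*(vab+vac))) := by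
  rcases le_or_gt (2*u0) (uab+uac) with hlu | hlu
  · exact conjF_c_union_of_light u0 uab uac ubc u3 v0 vab vac vbc v3 hu0 huab huac hubc hu3 hFBu hFCu hGZu (by linarith)
      hv0 hvab hvac hvbc hv3
  rcases le_or_gt (2*v0) (vab+vac) with hlv | hlv
  · rw [conjF_c_union_swap]
    exact conjF_c_union_of_light v0 vab vac vbc v3 u0 uab uac ubc u3 hv0 hvab hvac hvbc hv3 hFBv hFCv hGZv (by linarith)
      hu0 huab huac hubc hu3
  have hAu : 2*(u0+uab+uac)*(uab+uac+u3) ≤ 3*(uab+uac)*(u0+uab+uac+ubc+u3) := by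
    have e : 3*(uab+uac)*(u0+uab+uac+ubc+u3) - (u0+uab+uac)*(uab+3*uac+2*u3)
        + (3*(uab+uac)*(u0+uab+uac+ubc+u3) - (u0+uab+uac)*(3*uab+uac+2*u3))
        = 2*(3*(uab+uac)*(u0+uab+uac+ubc+u3) - 2*(u0+uab+uac)*(uab+uac+u3)) := by ring
    linarith
  have hAv : 2*(v0+vab+vac)*(vab+vac+v3) ≤ 3*(vab+vac)*(v0+vab+vac+vbc+v3) := by
    have e : 3*(vab+vac)*(v0+vab+vac+vbc+v3) - (v0+vab+vac)*(vab+3*vac+2*v3)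
        + (3*(vab+vac)*(v0+vab+vac+vbc+v3) - (v0+vab+vac)*(3*vab+vac+2*v3))
        = 2*(3*(vab+vac)*(v0+vab+vac+vbc+v3) - 2*(v0+vab+vac)*(vab+vac+v3)) := by ring
    linarith
  exact conjF_c_union_cc u0 uab uac ubc u3 v0 vab vac vbc v3 hu0 huab huac hubc hu3 hv0 hvab hvac hvbc hv3 huc (le_of_lt hlu)
    hAu hvc hAv

set_option maxHeartbeats 800000 in
/-- **LEMMA U″, two b-leaning pieces, target `F_b`** (`b ↔ c` mirror of `conjF_c_union_cc_all`): `u, v ≥ 0`, `uac ≤ uab`,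
`vac ≤ vab`, both satisfy `F_b`, `F_c`, GZ (5.1).  Then `F_b(u ∪ v) ≥ 0`.  (`F_c` of two b-leaning pieces is the leaf that is
certified only outside Lean.) [folklore] -/
theorem conjF_b_union_bb_all (u0 uab uac ubc u3 v0 vab vac vbc v3 : ℝ)
    (hu0 : 0 ≤ u0) (huab : 0 ≤ uab) (huac : 0 ≤ uac) (hubc : 0 ≤ ubc) (hu3 : 0 ≤ u3)
    (hv0 : 0 ≤ v0) (hvab : 0 ≤ vab) (hvac : 0 ≤ vac) (hvbc : 0 ≤ vbc) (hv3 : 0 ≤ v3)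
    (hub : uac ≤ uab) (hvb : vac ≤ vab)
    (hFBu : 0 ≤ 3*(uab+uac)*(u0+uab+uac+ubc+u3) - (u0+uab+uac)*(uab+3*uac+2*u3))
    (hFCu : 0 ≤ 3*(uab+uac)*(u0+uab+uac+ubc+u3) - (u0+uab+uac)*(3*uab+uac+2*u3))
    (hGZu : 0 ≤ (uab+uac+ubc)*(u0+uab+uac+ubc+u3) - uab^2 - uac^2 - (u0+ubc)*(uab+uac+u3))
    (hFBv : 0 ≤ 3*(vab+vac)*(v0+vab+vac+vbc+v3) - (v0+vab+vac)*(vab+3*vac+2*v3))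
    (hFCv : 0 ≤ 3*(vab+vac)*(v0+vab+vac+vbc+v3) - (v0+vab+vac)*(3*vab+vac+2*v3))
    (hGZv : 0 ≤ (vab+vac+vbc)*(v0+vab+vac+vbc+v3) - vab^2 - vac^2 - (v0+vbc)*(vab+vac+v3)) :
    0 ≤ 3*((u0*vab+uab*v0+uab*vab)+(u0*vac+uac*v0+uac*vac))*(u0*v0+(u0*vab+uab*v0+uab*vab)+(u0*vac+uac*v0+uac*vac)+(u0*vbc+ubc*v0+ubc*vbc)+(u3*(v0+vab+vac+vbc+v3)+(u0+uab+uac+ubc+u3)*v3-u3*v3+uab*(vac+vbc)+uac*(vab+vbc)+ubc*(vab+vac))) - (u0*v0+(u0*vab+uab*v0+uab*vab)+(u0*vac+uac*v0+uac*vac))*((u0*vab+uab*v0+uab*vab)+3*(u0*vac+uac*v0+uac*vac)+2*(u3*(v0+vab+vac+vbc+v3)+(u0+uab+uac+ubc+u3)*v3-u3*v3+uab*(vac+vbc)+uac*(vab+vbc)+ubc*(vab+vac))) := by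
  have h := conjF_c_union_cc_all u0 uac uab ubc u3 v0 vac vab vbc v3 hu0 huac huab hubc hu3 hv0 hvac hvab hvbc hv3 hub hvb
    (by have e : 3*(uac+uab)*(u0+uac+uab+ubc+u3) - (u0+uac+uab)*(uac+3*uab+2*u3)
          = 3*(uab+uac)*(u0+uab+uac+ubc+u3) - (u0+uab+uac)*(3*uab+uac+2*u3) := by ring
        rw [e]; exact hFCu)
    (by have e : 3*(uac+uab)*(u0+uac+uab+ubc+u3) - (u0+uac+uab)*(3*uac+uab+2*u3)
          = 3*(uab+uac)*(u0+uab+uac+ubc+u3) - (u0+uab+uac)*(uab+3*uac+2*u3) := by ring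
        rw [e]; exact hFBu)
    (by have e : (uac+uab+ubc)*(u0+uac+uab+ubc+u3) - uac^2 - uab^2 - (u0+ubc)*(uac+uab+u3)
          = (uab+uac+ubc)*(u0+uab+uac+ubc+u3) - uab^2 - uac^2 - (u0+ubc)*(uab+uac+u3) := by ring
        rw [e]; exact hGZu)
    (by have e : 3*(vac+vab)*(v0+vac+vab+vbc+v3) - (v0+vac+vab)*(vac+3*vab+2*v3)
          = 3*(vab+vac)*(v0+vab+vac+vbc+v3) - (v0+vab+vac)*(3*vab+vac+2*v3) := by ring
        rw [e]; exact hFCv)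
    (by have e : 3*(vac+vab)*(v0+vac+vab+vbc+v3) - (v0+vac+vab)*(3*vac+vab+2*v3)
          = 3*(vab+vac)*(v0+vab+vac+vbc+v3) - (v0+vab+vac)*(vab+3*vac+2*v3) := by ring
        rw [e]; exact hFBv)
    (by have e : (vac+vab+vbc)*(v0+vac+vab+vbc+v3) - vac^2 - vab^2 - (v0+vbc)*(vac+vab+v3)
          = (vab+vac+vbc)*(v0+vab+vac+vbc+v3) - vab^2 - vac^2 - (v0+vbc)*(vab+vac+v3) := by ring
        rw [e]; exact hGZv)
  have e : 3*((u0*vab+uab*v0+uab*vab)+(u0*vac+uac*v0+uac*vac))*(u0*v0+(u0*vab+uab*v0+uab*vab)+(u0*vac+uac*v0+uac*vac)+(u0*vbc+ubc*v0+ubc*vbc)+(u3*(v0+vab+vac+vbc+v3)+(u0+uab+uac+ubc+u3)*v3-u3*v3+uab*(vac+vbc)+uac*(vab+vbc)+ubc*(vab+vac))) - (u0*v0+(u0*vab+uab*v0+uab*vab)+(u0*vac+uac*v0+uac*vac))*((u0*vab+uab*v0+uab*vab)+3*(u0*vac+uac*v0+uac*vac)+2*(u3*(v0+vab+vac+vb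c+v3)+(u0+uab+uac+ubc+u3)*v3-u3*v3+uab*(vac+vbc)+uac*(vab+vbc)+ubc*(vab+vac)))
      = 3*((u0*vac+uac*v0+uac*vac)+(u0*vab+uab*v0+uab*vab))*(u0*v0+(u0*vac+uac*v0+uac*vac)+(u0*vab+uab*v0+uab*vab)+(u0*vbc+ubc*v0+ubc*vbc)+(u3*(v0+vac+vab+vbc+v3)+(u0+uac+uab+ubc+u3)*v3-u3*v3+uac*(vab+vbc)+uab*(vac+vbc)+ubc*(vac+vab))) - (u0*v0+(u0*vac+uac*v0+uac*vac)+(u0*vab+uab*v0+uab*vab))*(3*(u0*vac+uac*v0+uac*vac)+(u0*vab+uab*v0+uab*vab)+2*(u3*(v0+vac+vab+vbc+v3)+(u0+uac+uab+ubc+u3)*v3-u3*v3+uac*(vab+vbc)+uab*(vac+vbc)+ubc*(vac+vab))) := by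
    ring
  rw [e]; exact h

end APL

end Summit.CriticalPhenomena.PercolationContinuityZ3.Theorems
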